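import Mathlib
import Summits.RiemannHypothesis.RiemannHypothesis.Theorems.WeilParityOffLineParityDetectionTorusGramIntegrals
import Summits.RiemannHypothesis.RiemannHypothesis.Theorems.WeilParityOffLineParityDetectionTorusGramForms
import Summits.RiemannHypothesis.RiemannHypothesis.Theorems.WeilParityOffLineParityDetectionTorusGramCutoff
import Summits.RiemannHypothesis.RiemannHypothesis.Theorems.WeilParityOffLineParityDetectionTorusGramAssembly
import Summits.RiemannHypothesis.RiemannHypothesis.Theorems.WeilParityOffLineParityDetectionStubTorusTopHeavySeparated
import Summits.RiemannHypothesis.RiemannHypothesis.Theorems.WeilParityOffLineParityDetectionResidualCollLipschitz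
import HarnessLib

/-!
# Crux `OffLineParityDetection`, line `registered`: stub RESIDUAL-COLLAPSE (top-heaviness of the
# mirror-pairing form for one tight cluster of ordinates)

Route `WeilParity`, crux
`Summit.RiemannHypothesis.RiemannHypothesis.Theses.WeilParity.OffLineParityDetection`
(item stmt-RiemannHypothesis-15431), line `registered`.  This file proves the registered stub
`stub_residualCollapse` BY NAME, with the registered signature (`ζ`-free real analysis).

Setting: `η₀ > 0`, a finite nonempty top layer `T ⊂ {Re ρ = 1/2 + η₀}` with positive weights
`w`, the Laplace integrals `F_f(ρ) = ∫₀^∞ f e^{-(ρ-1/2)u} du` of smooth compactly supported real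
profiles on `[0, ∞)` and the mirror-pairing form `gain(a, f) = Σ_T w Re(e^{2i(Im ρ)a} F_f(ρ)²)`.
Hypothesis (one tight cluster): for some `ḡ ≥ 0`,
`2√2 · √(η₀² + ḡ²) · Σ_T w |(|Im ρ| - ḡ)| < η₀² Σ_T w`.  Conclusion (top-heaviness): at some
phase point `a` there are `D ≥ 0`, `δ > 0` with `-gain(a, f) ≤ D‖f‖²` for every profile and
`gain(a, f₀) ≥ (D + δ)‖f₀‖²` for one profile `f₀ ≠ 0`.

## Proof (RESIDUAL-analysis §2.2, the COLLAPSE tool; TORUS-analysis §1, the `J = 1` law)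

* NORMAL FORM (`…TorusGramForms`): `gain(a, f) = Σ_T w (C_ρ² - S_ρ²)` with
  `C_ρ = ⟨f, c_{|Im ρ|}⟩`, `S_ρ = ⟨f, s_{|Im ρ|}⟩`, `c_g = e^{-ηu}cos(g(u-a))`,
  `s_g = e^{-ηu}sin(g(u-a))`.
* COLLAPSE (`…ResidualCollLipschitz`): each term is operator-Lipschitz in its ordinate,
  `|(C_g² - S_g²) - (C_ḡ² - S_ḡ²)| ≤ K |g - ḡ| ‖f‖²`, `K = √2/(2η²)`, for `0 ≤ a ≤ 1/η`; hence
  `|gain(a, f) - M (C̄² - S̄²)| ≤ K L ‖f‖²` with `M = Σ w`, `L = Σ w |(|Im ρ| - ḡ)|`.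
* THE `J = 1` LAW at the phase point `a = arctan(ḡ/η)/(2ḡ) ∈ [0, 1/(2η)]` (`a = 0` if `ḡ = 0`):
  there `2η cos(2ḡa) + 2ḡ sin(2ḡa) = 2|z̄|`, `|z̄| = √(η² + ḡ²)`, so by the closed forms of
  `…TorusGramIntegrals` / `…TorusGramForms`: `⟨c̄, s̄⟩ = 0`, `‖c̄‖² = (1/(2η) + 1/(2|z̄|))/2`,
  `‖s̄‖² = (1/(2η) - 1/(2|z̄|))/2`.
* ASSEMBLY: `D := M ‖s̄‖² + K L` bounds the danger (`S̄² ≤ ‖f‖² ‖s̄‖²`); the ideal profile `c̄`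
  has collapsed gain `M ‖c̄‖⁴`, and `(M ‖s̄‖² + 2 K L) ‖c̄‖² < M ‖c̄‖⁴` is EXACTLY the hypothesis
  (`M(‖c̄‖² - ‖s̄‖²) = M/(2|z̄|)`, `2K = √2/η²`); the strict inequality passes to an admissible
  cut-off `f₀` of `c̄` (`torusSep_cutoff_select`), and COLLAPSE turns it into
  `gain(a, f₀) > D ‖f₀‖²`; `δ := (gain(a, f₀) - D‖f₀‖²)/‖f₀‖²`.
-/

set_option linter.dupNamespace false

noncomputable section

namespace Summit.RiemannHypothesis.RiemannHypothesis.Theorems.WeilParityOffLineParityDetection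

open MeasureTheory Set Filter Finset
open scoped ComplexConjugate
open Literature.NumberTheory.LFunctions

/-- **The phase point of the `J = 1` law.**  For `η > 0` and `g ≥ 0` there is `a ∈ [0, 1/(2η)]`
with `η cos(2ga) + g sin(2ga) = √(η² + g²)` and `g cos(2ga) - η sin(2ga) = 0`
(`a = arctan(g/η)/(2g)` for `g > 0`, using `arctan x ≤ x`; `a = 0` for `g = 0`). [folklore] -/
theorem resColl_phase {η : ℝ} (hη : 0 < η) {g : ℝ} (hg : 0 ≤ g) :
    ∃ a : ℝ, 0 ≤ a ∧ a ≤ 1 / (2 * η) ∧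
      η * Real.cos (2 * g * a) + g * Real.sin (2 * g * a) = Real.sqrt (η ^ 2 + g ^ 2) ∧
      g * Real.cos (2 * g * a) - η * Real.sin (2 * g * a) = 0 := by
  rcases hg.eq_or_lt with h0 | hg0
  · refine ⟨0, le_rfl, by positivity, ?_, ?_⟩
    · rw [← h0]
      simp [Real.sqrt_sq_eq_abs, abs_of_pos hη]
    · rw [← h0]
      simp
  · set t : ℝ := Real.arctan (g / η) with ht
    have ht0 : 0 ≤ t := Real.arctan_nonneg.2 (by positivity)
    have htle : t ≤ g / η := by
      have h := Real.le_tan ht0 (Real.arctan_lt_pi_div_two _)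
      rwa [Real.tan_arctan] at h
    have hr0 : 0 < Real.sqrt (η ^ 2 + g ^ 2) := Real.sqrt_pos.2 (by positivity)
    have hs : Real.sqrt (1 + (g / η) ^ 2) = Real.sqrt (η ^ 2 + g ^ 2) / η := by
      rw [show 1 + (g / η) ^ 2 = (η ^ 2 + g ^ 2) / η ^ 2 by field_simp,
        Real.sqrt_div (by positivity), Real.sqrt_sq hη.le]
    have e : 2 * g * (t / (2 * g)) = t := by field_simp
    refine ⟨t / (2 * g), by positivity, ?_, ?_, ?_⟩
    · rw [div_le_div_iff₀ (by positivity) (by positivity)]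
      calc t * (2 * η) ≤ g / η * (2 * η) := mul_le_mul_of_nonneg_right htle (by positivity)
        _ = 1 * (2 * g) := by field_simp
    · rw [e, ht, Real.cos_arctan, Real.sin_arctan, hs]
      have hsq := Real.sq_sqrt (by positivity : (0 : ℝ) ≤ η ^ 2 + g ^ 2)
      field_simp
      nlinarith [hsq]
    · rw [e, ht, Real.cos_arctan, Real.sin_arctan, hs]
      field_simp
      ring

/-- Stub **RESIDUAL-COLLAPSE** of crux `OffLineParityDetection` (line `registered`), `ζ`-free:
a top layer whose ordinates form ONE tight cluster around some `ḡ ≥ 0` in the weighted sense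
`2√2 · √(η₀² + ḡ²) · Σ_T w |(|Im ρ| - ḡ)| < η₀² Σ_T w` has a top-heavy mirror-pairing form,
at the phase point of the `J = 1` law of the collapsed cluster (danger bound
`D = (Σ w)‖s̄‖² + (√2/(2η₀²)) Σ w |(|Im ρ| - ḡ)|`, gaining profile a cut-off of
`e^{-η₀u} cos(ḡ(u-a))`); see the module docstring for the proof. [folklore] -/
theorem stub_residualCollapse :
    ∀ η₀ : ℝ, 0 < η₀ → ∀ T : Finset ℂ, T.Nonempty → (∀ ρ ∈ T, ρ.re = 1 / 2 + η₀) →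
      ∀ w : ℂ → ℝ, (∀ ρ ∈ T, 0 < w ρ) →
      (∃ gbar : ℝ, 0 ≤ gbar ∧
        2 * Real.sqrt 2 * Real.sqrt (η₀ ^ 2 + gbar ^ 2) * (∑ ρ ∈ T, w ρ * |(|ρ.im| - gbar)|) <
          η₀ ^ 2 * ∑ ρ ∈ T, w ρ) →
      ∃ δ : ℝ, 0 < δ ∧ ∃ a : ℝ, ∃ D : ℝ, 0 ≤ D ∧
        (∀ f : ℝ → ℝ, ContDiff ℝ (⊤ : ℕ∞) f → HasCompactSupport f → tsupport f ⊆ Set.Ici 0 →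
          -(∑ ρ ∈ T, w ρ * (Complex.exp (2 * (ρ.im : ℂ) * (a : ℂ) * Complex.I) *
              (∫ u in Set.Ioi (0 : ℝ), (f u : ℂ) * Complex.exp (-((ρ - 1 / 2) * (u : ℂ)))) ^ 2).re)
            ≤ D * ∫ u in Set.Ioi (0 : ℝ), f u ^ 2) ∧
        (∃ f : ℝ → ℝ, ContDiff ℝ (⊤ : ℕ∞) f ∧ HasCompactSupport f ∧ tsupport f ⊆ Set.Ici 0 ∧
          0 < ∫ u in Set.Ioi (0 : ℝ), f u ^ 2 ∧
          (D + δ) * ∫ u in Set.Ioi (0 : ℝ), f u ^ 2 ≤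
            ∑ ρ ∈ T, w ρ * (Complex.exp (2 * (ρ.im : ℂ) * (a : ℂ) * Complex.I) *
              (∫ u in Set.Ioi (0 : ℝ), (f u : ℂ) * Complex.exp (-((ρ - 1 / 2) * (u : ℂ)))) ^ 2).re) := by
  intro η hη T hTne hTre w hw hhyp
  classical
  obtain ⟨gb, hgb0, hlt⟩ := hhyp
  /- ### the phase point and the modulus `r = |z̄|` -/
  obtain ⟨a, ha0, ha1, hphase, hphase'⟩ := resColl_phase hη hgb0
  set r : ℝ := Real.sqrt (η ^ 2 + gb ^ 2) with hr
  have hr0 : 0 < r := Real.sqrt_pos.2 (by positivity)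
  have hrsq : r ^ 2 = η ^ 2 + gb ^ 2 := Real.sq_sqrt (by positivity)
  have hηr : η ≤ r := by
    rw [hr]
    calc η = Real.sqrt (η ^ 2) := (Real.sqrt_sq hη.le).symm
      _ ≤ Real.sqrt (η ^ 2 + gb ^ 2) := Real.sqrt_le_sqrt (by nlinarith)
  have ha1' : a ≤ 1 / η :=
    ha1.trans (div_le_div_of_nonneg_left zero_le_one hη (by linarith))
  /- ### weights -/
  set M : ℝ := ∑ ρ ∈ T, w ρ with hM
  have hM0 : 0 < M := Finset.sum_pos hw hTne
  set L : ℝ := ∑ ρ ∈ T, w ρ * |(|ρ.im| - gb)| with hL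
  have hL0 : 0 ≤ L := Finset.sum_nonneg fun ρ hρ ↦ mul_nonneg (hw ρ hρ).le (abs_nonneg _)
  /- ### closed forms at the phase point -/
  set Hf : ℝ → ℝ := fun ω ↦
    (2 * η * Real.cos (ω * a) + ω * Real.sin (ω * a)) / (4 * η ^ 2 + ω ^ 2) with hHf
  set Qf : ℝ → ℝ := fun ω ↦
    (ω * Real.cos (ω * a) - 2 * η * Real.sin (ω * a)) / (4 * η ^ 2 + ω ^ 2) with hQf
  have hH : ∀ ω, Hf ω = (2 * η * Real.cos (ω * a) + ω * Real.sin (ω * a)) / (4 * η ^ 2 + ω ^ 2) :=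
    fun ω ↦ rfl
  have hQ : ∀ ω, Qf ω = (ω * Real.cos (ω * a) - 2 * η * Real.sin (ω * a)) / (4 * η ^ 2 + ω ^ 2) :=
    fun ω ↦ rfl
  have hH0 : Hf (gb - gb) = 1 / (2 * η) := by
    rw [sub_self, hH]
    simp only [zero_mul, Real.cos_zero, mul_one, Real.sin_zero, mul_zero, add_zero, sq,
      zero_mul]
    field_simp
    ring
  have hH2 : Hf (gb + gb) = 1 / (2 * r) := by
    rw [← two_mul, hH]
    have hnum : 2 * η * Real.cos (2 * gb * a) + 2 * gb * Real.sin (2 * gb * a) = 2 * r := by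
      linear_combination 2 * hphase
    have hden : 4 * η ^ 2 + (2 * gb) ^ 2 = 4 * r ^ 2 := by
      rw [hrsq]
      ring
    rw [hnum, hden]
    field_simp
    ring
  have hQ0 : Qf (gb - gb) = 0 := by
    rw [sub_self, hQ]
    simp
  have hQ2 : Qf (gb + gb) = 0 := by
    rw [← two_mul, hQ]
    have hnum : 2 * gb * Real.cos (2 * gb * a) - 2 * η * Real.sin (2 * gb * a) = 0 := by
      linear_combination 2 * hphase'
    rw [hnum, zero_div]
  -- the Gram entries of the collapsed families `c̄ = c_gb`, `s̄ = s_gb`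
  set nc : ℝ := (1 / (2 * η) + 1 / (2 * r)) / 2 with hnc
  set ns : ℝ := (1 / (2 * η) - 1 / (2 * r)) / 2 with hns
  have hnc0 : 0 < nc := by positivity
  have hns0 : 0 ≤ ns := by
    have h : 1 / (2 * r) ≤ 1 / (2 * η) :=
      div_le_div_of_nonneg_left zero_le_one (by positivity) (by linarith)
    rw [hns]
    linarith
  have hdiff : nc - ns = 1 / (2 * r) := by
    rw [hnc, hns]
    ring
  have gram_ss : ∫ u in Ioi (0 : ℝ), Real.exp (-(η * u)) * Real.sin (gb * (u - a)) *
      (Real.exp (-(η * u)) * Real.sin (gb * (u - a))) = ns := by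
    rw [torusSep_gram_ss hη a gb gb hH, hH0, hH2]
  /- ### the constants -/
  set K : ℝ := Real.sqrt 2 / (2 * η ^ 2) with hK
  have hK0 : 0 ≤ K := by positivity
  set D : ℝ := M * ns + K * L with hD
  have hD0 : 0 ≤ D := by positivity
  -- the key numerical inequality (EXACTLY the hypothesis): `M ns + 2 K L < M nc`
  have hkey : M * ns + 2 * (K * L) < M * nc := by
    have h1 : 2 * (K * L) = Real.sqrt 2 * L / η ^ 2 := by
      rw [hK]
      field_simp
    have h2 : M * nc - M * ns = M / (2 * r) := by
      rw [← mul_sub, hdiff]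
      ring
    have h3 : Real.sqrt 2 * L / η ^ 2 < M / (2 * r) := by
      rw [div_lt_div_iff₀ (by positivity) (by positivity)]
      calc Real.sqrt 2 * L * (2 * r) = 2 * Real.sqrt 2 * r * L := by ring
        _ < η ^ 2 * M := hlt
        _ = M * η ^ 2 := by ring
    linarith
  /- ### the form on continuous compactly supported profiles -/
  -- normal form with absolute ordinates
  have hgain : ∀ f : ℝ → ℝ, Continuous f → HasCompactSupport f →
      ∑ ρ ∈ T, w ρ * (Complex.exp (2 * (ρ.im : ℂ) * (a : ℂ) * Complex.I) *
        (∫ u in Set.Ioi (0 : ℝ), (f u : ℂ) * Complex.exp (-((ρ - 1 / 2) * (u : ℂ)))) ^ 2).re =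
      ∑ ρ ∈ T, w ρ *
        ((∫ u in Ioi (0 : ℝ), f u * (Real.exp (-(η * u)) * Real.cos (|ρ.im| * (u - a)))) ^ 2 -
          (∫ u in Ioi (0 : ℝ), f u * (Real.exp (-(η * u)) * Real.sin (|ρ.im| * (u - a)))) ^ 2) :=
    fun f hf hfs ↦ Finset.sum_congr rfl fun ρ hρ ↦ by
      rw [torusSep_re_phase_laplace_sq_abs hf hfs (hTre ρ hρ) a]
  -- COLLAPSE: comparison with the collapsed form `M (C̄² - S̄²)`
  have hcomp : ∀ f : ℝ → ℝ, Continuous f → HasCompactSupport f →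
      |∑ ρ ∈ T, w ρ *
          ((∫ u in Ioi (0 : ℝ), f u * (Real.exp (-(η * u)) * Real.cos (|ρ.im| * (u - a)))) ^ 2 -
            (∫ u in Ioi (0 : ℝ), f u * (Real.exp (-(η * u)) * Real.sin (|ρ.im| * (u - a)))) ^ 2) -
        M * ((∫ u in Ioi (0 : ℝ), f u * (Real.exp (-(η * u)) * Real.cos (gb * (u - a)))) ^ 2 -
            (∫ u in Ioi (0 : ℝ), f u * (Real.exp (-(η * u)) * Real.sin (gb * (u - a)))) ^ 2)| ≤
      K * L * ∫ u in Ioi (0 : ℝ), f u ^ 2 := by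
    intro f hf hfs
    rw [hM, Finset.sum_mul, ← Finset.sum_sub_distrib]
    calc _ ≤ ∑ ρ ∈ T, |w ρ *
            ((∫ u in Ioi (0 : ℝ), f u * (Real.exp (-(η * u)) * Real.cos (|ρ.im| * (u - a)))) ^ 2 -
              (∫ u in Ioi (0 : ℝ), f u * (Real.exp (-(η * u)) * Real.sin (|ρ.im| * (u - a)))) ^ 2) -
          w ρ * ((∫ u in Ioi (0 : ℝ), f u * (Real.exp (-(η * u)) * Real.cos (gb * (u - a)))) ^ 2 -
            (∫ u in Ioi (0 : ℝ), f u * (Real.exp (-(η * u)) * Real.sin (gb * (u - a)))) ^ 2)| :=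
          Finset.abs_sum_le_sum_abs _ _
      _ ≤ ∑ ρ ∈ T, w ρ * (K * |(|ρ.im| - gb)| * ∫ u in Ioi (0 : ℝ), f u ^ 2) :=
          Finset.sum_le_sum fun ρ hρ ↦ by
            rw [← mul_sub, abs_mul, abs_of_pos (hw ρ hρ)]
            exact mul_le_mul_of_nonneg_left
              (resColl_term_lipschitz hη ha0 ha1' hf hfs _ _) (hw ρ hρ).le
      _ = K * L * ∫ u in Ioi (0 : ℝ), f u ^ 2 := by
          rw [hL, Finset.mul_sum, Finset.sum_mul]
          exact Finset.sum_congr rfl fun ρ _ ↦ by ring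
  /- ### the danger bound -/
  have hdanger : ∀ f : ℝ → ℝ, ContDiff ℝ (⊤ : ℕ∞) f → HasCompactSupport f → tsupport f ⊆ Set.Ici 0 →
      -(∑ ρ ∈ T, w ρ * (Complex.exp (2 * (ρ.im : ℂ) * (a : ℂ) * Complex.I) *
        (∫ u in Set.Ioi (0 : ℝ), (f u : ℂ) * Complex.exp (-((ρ - 1 / 2) * (u : ℂ)))) ^ 2).re) ≤
      D * ∫ u in Set.Ioi (0 : ℝ), f u ^ 2 := by
    intro f hf hfs _
    rw [hgain f hf.continuous hfs]
    have h1 := abs_le.1 (hcomp f hf.continuous hfs)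
    have h2 : (∫ u in Ioi (0 : ℝ), f u * (Real.exp (-(η * u)) * Real.sin (gb * (u - a)))) ^ 2 ≤
        (∫ u in Ioi (0 : ℝ), f u ^ 2) * ns := by
      rw [← gram_ss]
      exact resColl_pairing_sq_le hf.continuous hfs (by fun_prop)
        (torusSep_integrableOn_prod hη (by fun_prop) (by fun_prop) (fun u ↦ Real.abs_sin_le_one _)
          (fun u ↦ Real.abs_sin_le_one _))
    have h3 : 0 ≤ M * (∫ u in Ioi (0 : ℝ), f u * (Real.exp (-(η * u)) * Real.cos (gb * (u - a)))) ^ 2 :=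
      mul_nonneg hM0.le (sq_nonneg _)
    have h4 := mul_le_mul_of_nonneg_left h2 hM0.le
    rw [hD]
    linarith [h1.1, h3, h4]
  /- ### the gaining profile: a cut-off of `c̄` -/
  set p : ℝ → ℝ := fun u ↦ ∑ _i : Unit, (1 : ℝ) * (Real.exp (-(η * u)) * Real.cos (gb * (u - a)))
    with hpdef
  obtain ⟨hp1, hp2, hp3, hp4, hp5⟩ :=
    torusSep_profile (ι := Unit) hη a (fun _ ↦ gb) (fun _ ↦ (1 : ℝ)) hH hQ (p := p) (fun u ↦ rfl)
  have hp3' : ∫ u in Ioi (0 : ℝ), p u ^ 2 = nc := by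
    rw [hp3]
    simp only [Finset.sum_const, Finset.card_univ, Fintype.card_unit, one_smul, one_mul]
    rw [hH0, hH2]
  have hp4' : ∫ u in Ioi (0 : ℝ), p u * (Real.exp (-(η * u)) * Real.cos (gb * (u - a))) = nc := by
    rw [hp4 ()]
    simp only [Finset.sum_const, Finset.card_univ, Fintype.card_unit, one_smul, one_mul]
    rw [hH0, hH2]
  have hp5' : ∫ u in Ioi (0 : ℝ), p u * (Real.exp (-(η * u)) * Real.sin (gb * (u - a))) = 0 := by
    rw [hp5 ()]
    simp only [Finset.sum_const, Finset.card_univ, Fintype.card_unit, one_smul, one_mul]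
    rw [hQ0, hQ2]
    norm_num
  have hp_pos : 0 < ∫ u in Ioi (0 : ℝ), p u ^ 2 := by
    rw [hp3']
    exact hnc0
  -- the strict inequality for the COLLAPSED form at `p = c̄`
  have hstrict : (M * ns + 2 * (K * L)) * ∫ u in Ioi (0 : ℝ), p u ^ 2 <
      ∑ _i : Unit, M *
        ((∫ u in Ioi (0 : ℝ), p u * (Real.exp (-(η * u)) * Real.cos (gb * (u - a)))) ^ 2 -
          (∫ u in Ioi (0 : ℝ), p u * (Real.exp (-(η * u)) * Real.sin (gb * (u - a)))) ^ 2) := by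
    simp only [Finset.sum_const, Finset.card_univ, Fintype.card_unit, one_smul]
    rw [hp3', hp4', hp5']
    have h := mul_lt_mul_of_pos_right hkey hnc0
    nlinarith [h]
  obtain ⟨f₀, hf₀1, hf₀2, hf₀3, hf₀pos, hf₀strict⟩ := torusSep_cutoff_select (ι := Unit) hη hp1 hp2
    hp_pos (fun _ u ↦ Real.exp (-(η * u)) * Real.cos (gb * (u - a)))
    (fun _ u ↦ Real.exp (-(η * u)) * Real.sin (gb * (u - a)))
    (fun _ ↦ by fun_prop) (fun _ ↦ by fun_prop)
    (fun _ u _ ↦ torusSep_abs_damped_le Real.cos Real.abs_cos_le_one u _)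
    (fun _ u _ ↦ torusSep_abs_damped_le Real.sin Real.abs_sin_le_one u _) (fun _ ↦ M)
    (M * ns + 2 * (K * L)) hstrict
  simp only [Finset.sum_const, Finset.card_univ, Fintype.card_unit, one_smul] at hf₀strict
  /- ### the conclusion -/
  set Γ : ℝ := ∑ ρ ∈ T, w ρ *
    ((∫ u in Ioi (0 : ℝ), f₀ u * (Real.exp (-(η * u)) * Real.cos (|ρ.im| * (u - a)))) ^ 2 -
      (∫ u in Ioi (0 : ℝ), f₀ u * (Real.exp (-(η * u)) * Real.sin (|ρ.im| * (u - a)))) ^ 2) with hΓ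
  set E : ℝ := ∫ u in Ioi (0 : ℝ), f₀ u ^ 2 with hE
  have hΓE : D * E < Γ := by
    have h1 := abs_le.1 (hcomp f₀ hf₀1.continuous hf₀2)
    rw [hD]
    linarith [h1.1, hf₀strict]
  refine ⟨(Γ - D * E) / E, div_pos (by linarith) hf₀pos, a, D, hD0, hdanger, f₀, hf₀1, hf₀2,
    hf₀3, hf₀pos, ?_⟩
  rw [hgain f₀ hf₀1.continuous hf₀2, ← hΓ]
  apply le_of_eq
  field_simp
  ring

end Summit.RiemannHypothesis.RiemannHypothesis.Theorems.WeilParityOffLineParityDetection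

end
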